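import Literature.IUT.HodgeArakelov.AbsTopMonoidsNonVacuity

/-!
# [IUTchII] Example 1.8 (vii): NON-VACUITY of the interface `ProfiniteGroupifications` — exact inhabitation condition

Mochizuki, *Inter-universal Teichmüller theory II*, §1, Example 1.8 (vii), kurims manuscript (Dec. 2020)
p. 40 [claim: Mochizuki2012, status: disputed] (IUTchII §1 Ex 1.8 (vii), kurims p.40). Record-only vocabulary
under the claim key `Mochizuki2012` (D-0012, disputed); abc-iut cell, layer L6, NON-VACUITY CERTIFICATE
(L6-lead §F v1.18p «NV-L6 WAVE», row NV-L6/ProfiniteGroupifications; seat abc-iut-w5-d193) for abc-iut-L6-t1's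
interface `Literature.IUT.HodgeArakelov.ProfiniteGroupifications A Γ` (`AbsTopInterfaces.lean`: the outputs of
the groupification / profinite-completion algorithms `(*gp)`, `(*ĝp)` with the poly-isomorphism `α_ĝp`,
carried over an `A : AbsTopMonoids S`). abc-iut-w5-d114's INHABITATION CENSUS v3 found NO producer of this
type in the tree.

What the kernel says (this file is proof-only: no `def`, no `instance`, no named fact; witnesses are built
inside the theorem terms):

* `ProfiniteGroupifications.nonempty_of_subsingleton_units` — over ANY `A : AbsTopMonoids S` whose unit groups
  `O^×(G)` are trivial, and any group `Γ`, the interface is inhabited by the TRIVIAL groups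
  (`O^ĝp(G) := 1`, `M^ĝp_TM(Π) := 1`, `α_ĝp := id`, trivial `Γ`-actions) — injectivity of `O^× ↪ O^ĝp` being the
  only law that sees `A`, and it holds on a one-element group;
* `ProfiniteGroupifications.nonempty_degenerate` — hence over abc-iut-w5-d128/w4-d0xx's DEGENERATE
  `AbsTopMonoids.degenerate hΔ hq` (`AbsTopMonoidsNonVacuity.lean`, p417411: all monoids trivial) the interface
  IS inhabited. HONEST LABEL: DEGENERATE (trivial groups; the profinite-completion functor is not in the tree —
  MERGE-MAP row B9 / TODO-merge:abc-iut-L4-t3 carries the genuine `O^ĝp`, `M^ĝp_TM`);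
* `ProfiniteGroupifications.exists_nonempty_iff` — **the exact inhabitation condition**:
  `(∃ A : AbsTopMonoids S, Nonempty (ProfiniteGroupifications A Γ)) ↔ (H1) ∧ (H2)`, the same two hidden
  hypotheses «`Δ ⊆ Π` characteristic» and «`Π^tp_{X̲̲_k}/Δ ≅ G_k`» that govern `AbsTopMonoids S` itself
  (`AbsTopMonoids.nonempty_iff`) — the groupification layer adds NO further constraint on the setting.
Nothing here bears on [IUTchIII] Cor. 3.12; no side is taken; a degenerate witness certifies joint
satisfiability of the typed laws, nothing about the genuine [AbsTopIII] objects.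
-/

noncomputable section

namespace Literature.IUT.HodgeArakelov

open CategoryTheory

universe u

variable {S : ThetaSetting.{u}}

namespace ProfiniteGroupifications

/-- **Inhabited over any `A` with trivial unit groups** (trivial `O^ĝp`, `M^ĝp_TM`, identity `α_ĝp`, trivial
`Γ`-actions; the injectivity law `O^×(G) ↪ O^ĝp(G)` holds because `O^×(G)` is a one-element group).
DEGENERATE witness. [claim: Mochizuki2012, status: disputed] (IUTchII §1 Ex 1.8 (vii), kurims p.40) -/
theorem nonempty_of_subsingleton_units (A : AbsTopMonoids S) (Γ : Type u) [Group Γ]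
    (h : ∀ G : IsoClass S.Gk, Subsingleton (A.Ounits G)) : Nonempty (ProfiniteGroupifications A Γ) :=
  ⟨{ Oghat := fun _ => PUnit.{u + 1}
     unitsToOghat := fun _ => 1
     unitsToOghat_injective := fun G => haveI := h G; Function.injective_of_subsingleton _
     Mghat := fun _ => PUnit.{u + 1}
     toMghat := fun _ => 1
     actΓO := fun _ => 1
     actΓM := fun _ => 1
     alphaGhat := fun _ => MulEquiv.refl _
     alphaGhat_compat := fun _ _ => rfl }⟩

/-- **NON-VACUITY (DEGENERATE)**: over the degenerate `AbsTopMonoids.degenerate hΔ hq` of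
`AbsTopMonoidsNonVacuity.lean` (all monoids `O^⊳(G)`, `M_TM(Π)` trivial) the interface `ProfiniteGroupifications`
is inhabited, for every group `Γ`. degenerate: trivial carriers. [claim: Mochizuki2012, status: disputed]
(IUTchII §1 Ex 1.8 (vii), kurims p.40) -/
theorem nonempty_degenerate
    (hΔ : ∀ f : S.PiX ≃ₜ* S.PiX, S.DeltaX.map f.toMulEquiv.toMonoidHom = S.DeltaX)
    (hq : Nonempty (TopGroup.quot S.PiX S.DeltaX ≃ₜ* S.Gk)) (Γ : Type u) [Group Γ] :
    Nonempty (ProfiniteGroupifications (AbsTopMonoids.degenerate hΔ hq) Γ) :=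
  nonempty_of_subsingleton_units _ Γ fun _ => inferInstanceAs (Subsingleton (PUnit.{u + 1})ˣ)

/-- **The exact inhabitation condition of `ProfiniteGroupifications` over the setting `S`**: some
`A : AbsTopMonoids S` carries a `ProfiniteGroupifications A Γ` iff (H1) `Δ` is carried onto itself by every
automorphism of topological groups of `Π^tp_{X̲̲_k}` and (H2) `Π^tp_{X̲̲_k}/Δ ≅ G_k` — exactly
`AbsTopMonoids.nonempty_iff`: the groupification layer adds no constraint on `S`.
[claim: Mochizuki2012, status: disputed] (IUTchII §1 Ex 1.8 (vii), kurims p.40) -/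
theorem exists_nonempty_iff (Γ : Type u) [Group Γ] :
    (∃ A : AbsTopMonoids S, Nonempty (ProfiniteGroupifications A Γ)) ↔
      (∀ f : S.PiX ≃ₜ* S.PiX, S.DeltaX.map f.toMulEquiv.toMonoidHom = S.DeltaX) ∧
        Nonempty (TopGroup.quot S.PiX S.DeltaX ≃ₜ* S.Gk) :=
  ⟨fun ⟨A, _⟩ => AbsTopMonoids.nonempty_iff.mp ⟨A⟩,
    fun ⟨hΔ, hq⟩ => ⟨AbsTopMonoids.degenerate hΔ hq, nonempty_degenerate hΔ hq Γ⟩⟩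

end ProfiniteGroupifications

end Literature.IUT.HodgeArakelov

end
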